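import Summits.Ventures.CertifiedManyBodySolver.Downfold.StiffnessSeam
import Summits.Ventures.CertifiedManyBodySolver.Downfold.BoxesNdNiO2E
import Summits.Ventures.CertifiedManyBodySolver.Certificates.HubbardSquare_NdM21BoxE_stiffness_kinematic
import HarnessLib

/-!
# The DOPING-CHAIN box of BOX OF RECORD #20 (NdNiO₂ family, object E, P = 0): `boxNdNiO2E_dopingChain` = the family rows × `n ∈ [343/500, 477/500]`,
# REFINED by all four typed columns M21 / M59 / M22 / M60 — one word on the chain words the four columns; cell-leaf closer; kinematic words

Venture CertifiedManyBodySolver, cell `pub/hubbard-downfold` (MO-S1 ↔ S2 seam, D-0154 (1)(C) COVERAGE material (iii) NdNiO₂; obs RULING (mmm) d309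
(3) crux K3 «ANY-DENSITY transport across the doped filling interval, Δn load-bearing»); namespace `Summit.Ventures.CertifiedManyBodySolver.Downfold`.
Written by seat hubbard-cov-ndnio2-unc-3 (`prover-hubbard-cov-ndnio2-unc-3-0`; lane «filling / doping-column ladder», lead RULING R-ma 2026-08-28T05:18:00Z).
Companion of `Downfold/BoxesNdNiO2FillingLadder.lean` (same seat: the dsd objects, the per-column `n` rows and the CHAIN FACT — adjacent column
`n` entries overlap, union `[0.686, 0.954]`) and of the typed boxes of record `Downfold/BoxesNdNiO2E.lean` (never edited here).

* `ndNiO2Fill_n_chain = [343/500, 477/500]`; `boxNdNiO2E_dopingChain` (U/t_eff `[5, 17/2]`, tp/t_eff `[−23/50, −9/25]`, n the chain entry, t_eff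
  `[19/50, 49/100]`, tpp `0` — the family rows verbatim; NOT a box of record, a typed UNION for transport); `boxNdNiO2E_dopingChain_mem_iff`;
* `boxNdNiO2E_M21_refines_dopingChain`, `boxNdSrNiO2E_M59_…`, `…M22_…` (hence the M279 bulk column, which carries the M22 `n` row), `…M60_…`;
  `holdsOn_ndNiO2_columns_of_dopingChain` — ONE word on the chain ⇒ the word on M21 ∧ M59 ∧ M22 ∧ M60;
* corners `(5, −23/50, 343/500) / (17/2, −9/25, 477/500)`; `boxNdNiO2E_dopingChain_stiffnessWord_of_cellLeaf` (the K3 obligation shape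
  `∀ tp U n ∈ cell, ObsStiffnessSeqCeilingAt tp U n c` ⇒ the chain word) and `ndNiO2_columns_stiffnessWord_of_chainCellLeaf`;
* today's unconditional words on the whole chain from hubbard-tc p1's kernel leaf `ndBoxE_parentM21col_*` (`t′ ∈ [−23/50, −9/25]`, `n ≤ 477/500`):
  ground-state `0.4877121`, thermal twin, KT reading `T_c ≤ 0.3830482` (tree units; 2D single-layer MODEL). The per-column constants
  `0.4877121 / 0.4509038 / 0.4736879 / 0.4414575` (M21 / M22 / M59 / M60) are `Downfold/BoxesNdNiO2EStiffnessKinematic.lean` (cov-ndnio2-box-1 and -box-2).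

Everything here is PROVED (definitions with bodies; no `sorry`). HONEST FRAMING: a typed union of S1's SYSTEMATIC (screening-grade) columns and the
transfer rule between them; typing certifies nothing about NdNiO₂; the stiffness words are one-sided CEILINGS (CONTROL/CALIBRATION wording class; a
ceiling never speaks to the presence of order; `U/t` is idle in the kinematic ones); no phase sentence; no box of record is edited; no summit
statement is proved by this file.
-/

noncomputable section

namespace Summit.Ventures.CertifiedManyBodySolver.Downfold

open Set NonemptyInterval
open Summit.Ventures.CertifiedManyBodySolver.Observables
open Summit.Ventures.CertifiedManyBodySolver.Certificates
open Literature.MathematicalPhysics.QuantumLattice Literature.MathematicalPhysics.QuantumLattice.ThermodynamicLimit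

/-! ## §1 The doping-chain box and its four `Refines` transfers -/

/-- **The `n` entry of the doping chain**: `[343/500, 477/500] = [0.686, 0.954]` = the union of the four column entries. [folklore] -/
def ndNiO2Fill_n_chain : Entry := Entry.ofEnds (343 / 500) (477 / 500) (by norm_num) .screening

/-- **The DOPING-CHAIN box `boxNdNiO2E_dopingChain`** (object E, NdNiO₂ family, P = 0; NOT a box of record — a typed UNION for transport):
`U/t_eff ∈ [5, 8.5]`, `tp/t_eff ∈ [−0.46, −0.36]`, `t_eff ∈ [0.38, 0.49] eV`, `tpp/t_eff = 0` (the family rows, shared by all four columns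
verbatim) and `n ∈ [0.686, 0.954]`; other coordinates UNDETERMINED. [folklore] -/
def boxNdNiO2E_dopingChain : OneBandBox := fun c =>
  match c with
  | .UOverT => some ndNiO2E_M21_U
  | .tpOverT => some ndNiO2E_M21_tp
  | .filling => some ndNiO2Fill_n_chain
  | .tEV => some ndNiO2E_M21_t
  | .tppOverT => some ndNiO2E_M21_tpp
  | _ => none

/-- **Membership in `boxNdNiO2E_dopingChain` unfolded.** [folklore] -/
theorem boxNdNiO2E_dopingChain_mem_iff (p : OneBandCoord → ℝ) :
    boxNdNiO2E_dopingChain.Mem p ↔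
      ((5 : ℚ) : ℝ) ≤ p .UOverT ∧ p .UOverT ≤ (((17/2) : ℚ) : ℝ) ∧
      (((-23/50) : ℚ) : ℝ) ≤ p .tpOverT ∧ p .tpOverT ≤ (((-9/25) : ℚ) : ℝ) ∧
      (((343/500) : ℚ) : ℝ) ≤ p .filling ∧ p .filling ≤ (((477/500) : ℚ) : ℝ) ∧
      (((19/50) : ℚ) : ℝ) ≤ p .tEV ∧ p .tEV ≤ (((49/100) : ℚ) : ℝ) ∧
      ((0 : ℚ) : ℝ) ≤ p .tppOverT ∧ p .tppOverT ≤ ((0 : ℚ) : ℝ) := by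
  constructor
  · intro h
    have h0 := (Entry.mem_ofEnds_iff _ _ _ _ _).1 (h .UOverT ndNiO2E_M21_U rfl)
    have h1 := (Entry.mem_ofEnds_iff _ _ _ _ _).1 (h .tpOverT ndNiO2E_M21_tp rfl)
    have h2 := (Entry.mem_ofEnds_iff _ _ _ _ _).1 (h .filling ndNiO2Fill_n_chain rfl)
    have h3 := (Entry.mem_ofEnds_iff _ _ _ _ _).1 (h .tEV ndNiO2E_M21_t rfl)
    have h4 := (Entry.mem_ofEnds_iff _ _ _ _ _).1 (h .tppOverT ndNiO2E_M21_tpp rfl)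
    exact ⟨h0.1, h0.2, h1.1, h1.2, h2.1, h2.2, h3.1, h3.2, h4.1, h4.2⟩
  · rintro ⟨a0, b0, a1, b1, a2, b2, a3, b3, a4, b4⟩ i e hi
    cases i <;> simp only [boxNdNiO2E_dopingChain, Option.some.injEq, reduceCtorEq] at hi <;> subst hi
    · exact (Entry.mem_ofEnds_iff _ _ _ _ _).2 ⟨a0, b0⟩
    · exact (Entry.mem_ofEnds_iff _ _ _ _ _).2 ⟨a1, b1⟩
    · exact (Entry.mem_ofEnds_iff _ _ _ _ _).2 ⟨a2, b2⟩
    · exact (Entry.mem_ofEnds_iff _ _ _ _ _).2 ⟨a3, b3⟩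
    · exact (Entry.mem_ofEnds_iff _ _ _ _ _).2 ⟨a4, b4⟩

/-- **M21 ⊆ chain.** [folklore] -/
theorem boxNdNiO2E_M21_refines_dopingChain : boxNdNiO2E_M21.Refines boxNdNiO2E_dopingChain := by
  intro p hp
  obtain ⟨a0, b0, a1, b1, a2, b2, a3, b3, a4, b4⟩ := (boxNdNiO2E_M21_mem_iff p).1 hp
  refine (boxNdNiO2E_dopingChain_mem_iff p).2 ⟨a0, b0, a1, b1, le_trans ?_ a2, b2, a3, b3, a4, b4⟩
  norm_num

/-- **M59 ⊆ chain.** [folklore] -/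
theorem boxNdSrNiO2E_M59_refines_dopingChain : boxNdSrNiO2E_M59.Refines boxNdNiO2E_dopingChain := by
  intro p hp
  obtain ⟨a0, b0, a1, b1, a2, b2, a3, b3, a4, b4⟩ := (boxNdSrNiO2E_M59_mem_iff p).1 hp
  refine (boxNdNiO2E_dopingChain_mem_iff p).2 ⟨a0, b0, a1, b1, le_trans ?_ a2, le_trans b2 ?_, a3, b3, a4, b4⟩ <;> norm_num

/-- **M22 ⊆ chain** (hence also the M279 bulk column, which carries the M22 `n` row and the family rows). [folklore] -/
theorem boxNdSrNiO2E_M22_refines_dopingChain : boxNdSrNiO2E_M22.Refines boxNdNiO2E_dopingChain := by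
  intro p hp
  obtain ⟨a0, b0, a1, b1, a2, b2, a3, b3, a4, b4⟩ := (boxNdSrNiO2E_M22_mem_iff p).1 hp
  refine (boxNdNiO2E_dopingChain_mem_iff p).2 ⟨a0, b0, a1, b1, le_trans ?_ a2, le_trans b2 ?_, a3, b3, a4, b4⟩ <;> norm_num

/-- **M60 ⊆ chain.** [folklore] -/
theorem boxNdSrNiO2E_M60_refines_dopingChain : boxNdSrNiO2E_M60.Refines boxNdNiO2E_dopingChain := by
  intro p hp
  obtain ⟨a0, b0, a1, b1, a2, b2, a3, b3, a4, b4⟩ := (boxNdSrNiO2E_M60_mem_iff p).1 hp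
  refine (boxNdNiO2E_dopingChain_mem_iff p).2 ⟨a0, b0, a1, b1, a2, le_trans b2 ?_, a3, b3, a4, b4⟩
  norm_num

/-- **ONE WORD ON THE CHAIN WORDS ALL FOUR TYPED COLUMNS** (the «one solve, four columns» transfer K3 is priced against). [folklore] -/
theorem holdsOn_ndNiO2_columns_of_dopingChain {W : (OneBandCoord → ℝ) → Prop} (h : HoldsOn W boxNdNiO2E_dopingChain) :
    HoldsOn W boxNdNiO2E_M21 ∧ HoldsOn W boxNdSrNiO2E_M59 ∧ HoldsOn W boxNdSrNiO2E_M22 ∧ HoldsOn W boxNdSrNiO2E_M60 :=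
  ⟨h.of_refines boxNdNiO2E_M21_refines_dopingChain, h.of_refines boxNdSrNiO2E_M59_refines_dopingChain,
    h.of_refines boxNdSrNiO2E_M22_refines_dopingChain, h.of_refines boxNdSrNiO2E_M60_refines_dopingChain⟩

/-! ## §2 The delivered box, the cell-leaf closer, today's kinematic words -/

/-- Lower corner of the delivered S2 box of the chain: `(5, −0.46, 0.686)`. [folklore] -/
theorem ndNiO2_dopingChain_s2Lo : s2Lo ndNiO2E_M21_U ndNiO2E_M21_tp ndNiO2Fill_n_chain = ![5, -23/50, 343/500] := by
  ext i; fin_cases i <;> simp [s2Lo, ndNiO2E_M21_U, ndNiO2E_M21_tp, ndNiO2Fill_n_chain]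

/-- Upper corner of the delivered S2 box of the chain: `(8.5, −0.36, 0.954)`. [folklore] -/
theorem ndNiO2_dopingChain_s2Hi : s2Hi ndNiO2E_M21_U ndNiO2E_M21_tp ndNiO2Fill_n_chain = ![17/2, -9/25, 477/500] := by
  ext i; fin_cases i <;> simp [s2Hi, ndNiO2E_M21_U, ndNiO2E_M21_tp, ndNiO2Fill_n_chain]

/-- Coordinates of a point of the delivered chain box `Set.Icc ![5, −23/50, 343/500] ![17/2, −9/25, 477/500]` (order `(U/t, t'/t, n)`). [folklore] -/
theorem mem_ndNiO2_dopingChain_s2Box {θ : Fin 3 → ℝ}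
    (hθ : θ ∈ Set.Icc (![5, -23/50, 343/500] : Fin 3 → ℝ) ![17/2, -9/25, 477/500]) :
    (5 ≤ θ 0 ∧ θ 0 ≤ 17 / 2) ∧ (-23 / 50 ≤ θ 1 ∧ θ 1 ≤ -9 / 25) ∧ (343 / 500 ≤ θ 2 ∧ θ 2 ≤ 477 / 500) := by
  rw [Set.mem_Icc, Pi.le_def, Pi.le_def] at hθ
  obtain ⟨hlo, hhi⟩ := hθ
  have h0 := hlo 0; have h1 := hlo 1; have h2 := hlo 2
  have h0' := hhi 0; have h1' := hhi 1; have h2' := hhi 2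
  simp only [Matrix.cons_val_zero, Matrix.cons_val_one, Matrix.head_cons, Matrix.cons_val_two,
    Matrix.tail_cons] at h0 h1 h2 h0' h1' h2'
  exact ⟨⟨h0, h0'⟩, ⟨h1, h1'⟩, ⟨h2, h2'⟩⟩

/-- **ANY-DENSITY cell leaf ⇒ the stiffness word on the whole chain** (hence on every column by `holdsOn_ndNiO2_columns_of_dopingChain`):
`∀ tp ∈ [−23/50, −9/25], ∀ U ∈ [5, 17/2], ∀ n ∈ [343/500, 477/500], ObsStiffnessSeqCeilingAt tp U n c` gives
`HoldsOn (p ↦ ObsStiffnessSeqCeilingAt (p tp) (p U) (p n) c) boxNdNiO2E_dopingChain`. The K3 obligation shape (obs RULING (mmm) d309 (3)).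
[cite: ScalapinoWhiteZhang1993, §II] -/
theorem boxNdNiO2E_dopingChain_stiffnessWord_of_cellLeaf {c : ℚ}
    (hW : ∀ tp ∈ Set.Icc (-23 / 50 : ℝ) (-9 / 25), ∀ U ∈ Set.Icc (5 : ℝ) (17 / 2),
      ∀ n ∈ Set.Icc (343 / 500 : ℝ) (477 / 500), ObsStiffnessSeqCeilingAt tp U n c) :
    HoldsOn (fun p : OneBandCoord → ℝ => ObsStiffnessSeqCeilingAt (p .tpOverT) (p .UOverT) (p .filling) c)
      boxNdNiO2E_dopingChain := by
  refine holdsOn_of_forall_s2Box (B := boxNdNiO2E_dopingChain) (eU := ndNiO2E_M21_U) (eS := ndNiO2E_M21_tp)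
    (eN := ndNiO2Fill_n_chain) rfl rfl rfl
    (W := fun θ => ObsStiffnessSeqCeilingAt (θ 1) (θ 0) (θ 2) c) ?_
  rw [ndNiO2_dopingChain_s2Lo, ndNiO2_dopingChain_s2Hi]
  intro θ hθ
  obtain ⟨hUθ, htθ, hnθ⟩ := mem_ndNiO2_dopingChain_s2Box hθ
  exact hW (θ 1) htθ (θ 0) hUθ (θ 2) hnθ

/-- The same leaf words every typed column (M21, M59, M22, M60) through the chain. [cite: ScalapinoWhiteZhang1993, §II] -/
theorem ndNiO2_columns_stiffnessWord_of_chainCellLeaf {c : ℚ}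
    (hW : ∀ tp ∈ Set.Icc (-23 / 50 : ℝ) (-9 / 25), ∀ U ∈ Set.Icc (5 : ℝ) (17 / 2),
      ∀ n ∈ Set.Icc (343 / 500 : ℝ) (477 / 500), ObsStiffnessSeqCeilingAt tp U n c) :
    HoldsOn (fun p : OneBandCoord → ℝ => ObsStiffnessSeqCeilingAt (p .tpOverT) (p .UOverT) (p .filling) c) boxNdNiO2E_M21 ∧
      HoldsOn (fun p : OneBandCoord → ℝ => ObsStiffnessSeqCeilingAt (p .tpOverT) (p .UOverT) (p .filling) c) boxNdSrNiO2E_M59 ∧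
      HoldsOn (fun p : OneBandCoord → ℝ => ObsStiffnessSeqCeilingAt (p .tpOverT) (p .UOverT) (p .filling) c) boxNdSrNiO2E_M22 ∧
      HoldsOn (fun p : OneBandCoord → ℝ => ObsStiffnessSeqCeilingAt (p .tpOverT) (p .UOverT) (p .filling) c) boxNdSrNiO2E_M60 :=
  holdsOn_ndNiO2_columns_of_dopingChain (boxNdNiO2E_dopingChain_stiffnessWord_of_cellLeaf hW)

/-- **TODAY'S UNCONDITIONAL STIFFNESS WORD ON THE WHOLE CHAIN** (kinematic, node-free, `U`-free): `ρ_s ≤ 0.4877121` at every point of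
`boxNdNiO2E_dopingChain` — hubbard-tc p1's kernel leaf `ndBoxE_parentM21col_stiffnessSeqLeaf` (`t′ ∈ [−23/50, −9/25]`, `0 ≤ n ≤ 477/500`)
covers the chain's whole filling range; the per-column kernel constants `0.4509038 / 0.4736879 / 0.4414575` (M22 / M59 / M60) are smaller and live in
`Downfold/BoxesNdNiO2EStiffnessKinematic.lean` (cov-ndnio2-box-1 and -box-2), the M21 one is this very constant. [cite: HazraVermaRanderia2019, eqs. (2)-(6)] -/
theorem boxNdNiO2E_dopingChain_stiffness_kinematic :
    HoldsOn (fun p : OneBandCoord → ℝ =>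
      ObsStiffnessSeqCeilingAt (p .tpOverT) (p .UOverT) (p .filling) (4877121 / 10000000)) boxNdNiO2E_dopingChain :=
  boxNdNiO2E_dopingChain_stiffnessWord_of_cellLeaf fun _tp htp _U _ n hn =>
    ndBoxE_parentM21col_stiffnessSeqLeaf htp (by linarith [hn.1]) hn.2

/-- **The thermal twin on the chain** (every temperature): `ObsThermalStiffnessSeqCeilingAt … 0.4877121`. [cite: ParamekantiTrivediRanderia1998, eq. (3) and §IV] -/
theorem boxNdNiO2E_dopingChain_thermalStiffness_kinematic :
    HoldsOn (fun p : OneBandCoord → ℝ =>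
      ObsThermalStiffnessSeqCeilingAt (p .tpOverT) (p .UOverT) (p .filling) (4877121 / 10000000)) boxNdNiO2E_dopingChain := by
  refine holdsOn_of_forall_s2Box (B := boxNdNiO2E_dopingChain) (eU := ndNiO2E_M21_U) (eS := ndNiO2E_M21_tp)
    (eN := ndNiO2Fill_n_chain) rfl rfl rfl
    (W := fun θ => ObsThermalStiffnessSeqCeilingAt (θ 1) (θ 0) (θ 2) (4877121 / 10000000)) ?_
  rw [ndNiO2_dopingChain_s2Lo, ndNiO2_dopingChain_s2Hi]
  intro θ hθ
  obtain ⟨-, htθ, hnθ⟩ := mem_ndNiO2_dopingChain_s2Box hθ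
  exact ndBoxE_parentM21col_thermalStiffnessSeqLeaf htθ (by linarith [hnθ.1]) hnθ.2

/-- **KT reading on the chain** (CONDITIONAL on the monotonicity-free KT dictionary at the point; 2D single-layer MODEL, not a material
`T_c`): `T_c ≤ 0.3830482` (tree units). [cite: HazraVermaRanderia2019, eqs. (2)-(3) and App. G] -/
theorem boxNdNiO2E_dopingChain_Tc_le_kinematic_KT :
    HoldsOn (fun p : OneBandCoord → ℝ => ∀ (ρe : ℝ → ℝ) (Tc : ℝ),
      ThermalKTDictionaryAt (p .tpOverT) (p .UOverT) (p .filling) ρe Tc → Tc ≤ 0.3830482) boxNdNiO2E_dopingChain := by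
  refine holdsOn_of_forall_s2Box (B := boxNdNiO2E_dopingChain) (eU := ndNiO2E_M21_U) (eS := ndNiO2E_M21_tp)
    (eN := ndNiO2Fill_n_chain) rfl rfl rfl
    (W := fun θ => ∀ (ρe : ℝ → ℝ) (Tc : ℝ), ThermalKTDictionaryAt (θ 1) (θ 0) (θ 2) ρe Tc → Tc ≤ 0.3830482) ?_
  rw [ndNiO2_dopingChain_s2Lo, ndNiO2_dopingChain_s2Hi]
  intro θ hθ ρe Tc hKT
  obtain ⟨-, htθ, hnθ⟩ := mem_ndNiO2_dopingChain_s2Box hθ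
  exact Summit.Ventures.CertifiedManyBodySolver.Certificates.ThermalKTDictionaryAt.ndBoxE_parentM21col_le_decimal htθ
    (by linarith [hnθ.1]) hnθ.2 hKT

end Summit.Ventures.CertifiedManyBodySolver.Downfold

end
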